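import Summits.Schanuel.Schanuel.Theorems.RootDecomp1KKummerCells
import Literature.NumberTheory.Transcendental.ExpLogSimultaneousApproximationMeasure

/-!
# RootDecomp1K — «RADICAL CELLS» (lens 6 «DarkCarving/HyperCarving», gen 11 = 1K ROUND 8, THEOREM ROUND, PATH T)

Route `route-Schanuel-RootDecomp1K` (DRAFT rev 8) is UNCHANGED by this file: no item, no `closes` edit.  This is
a kernel-checked THEOREM file supporting crux A₄ʰ = `RootDecomp1K.HyperLiouvilleSchanuel` (stmt-Schanuel-33363):
it DECIDES the `n = 2, 3` line-cells `z = (u, ρu)` / `z = (u, ρu, w)` of A₄ʰ at every anchor `u` whose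
exponential `e^u` has FINITE TRANSCENDENCE TYPE, by ONE engine, and instantiates the engine at three anchor
classes — two of them UNCONDITIONAL in the tree.

## The engine (§23)

`FiniteTranscendenceType y` (Lang): `∃ c > 0, τ, ∀ S ∈ ℤ[X] ∖ 0, deg S ≤ N, H(S) ≤ H ⇒ |S(y)| ≥ exp(−c (N + log H)^τ)`.

**`radical_aeval_ne_zero` / `algebraicIndependent_radical`.**  `e^u = y` of finite transcendence type,
`ρ > 0` hyper-Liouville (`HyperCell.HyperLiouville`, tree) ⇒ `(ρ, y, e^{uρ})` algebraically independent / ℚ.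

MECHANISM (radical conjugates over the TRANSCENDENTAL base `y`).  A relation `P(ρ, y, e^{uρ}) = 0`; at a
super-approximant `p/q` of `ρ`, `w := e^{up/q}` is a RADICAL over the base: `w^q = y^p`.  The eliminant
`S(Y) := Res_W(W^q − Y^p, q^D P(p/q, Y, W)) ∈ ℤ[Y]` (§23b: product formula `S(y) = ∏_{b^q = y^p} q^D P(p/q, y, b)`,
degree `≤ qK + pN` by a Leibniz expansion of the Sylvester determinant, height `≤ (max 1 ‖G‖₁)^q` by PARSEVAL on
the unit circle, §23c) does not vanish at `y`: NO conjugate factor vanishes, by the FUNCTION-FIELD KUMMER LEMMA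
over `ℚ(y)` (§23a `ffKummer_eval_ne_zero`: for `y` transcendental and `gcd(p, q) = 1` a root of `W^q − y^p` has
degree `≥ q` over `ℚ(y)` — orders of vanishing at `Y = 0`; so no `H ∈ ℚ(y)[W] ∖ 0` of degree `< q` kills it).
The special factor (`b = w`) is `≤ Q^D·Kl·|ρ − p/q| < e^{A₁Q²}e^{−Q^m}` (a `C¹` Lipschitz bound, §23f), the
others `≤ Q^D B'`, while the measure of the FIXED number `y` gives `|S(y)| ≥ e^{−A₃ Q^{2k}}` — contradiction.
The point of norming down to `ℚ(y)`: only a measure of the q-INDEPENDENT base `y = e^u` is consumed (any finite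
type), never a measure of `e^{u/q}` uniform in `q` (contrast g9 §17's `E = e^{1/q}` substitution, which needs the
explicit-in-`r` statement `ExplicitRatExpApprox`).

## Instances and cells (§24–25) — `SB N z :=` Schanuel's bound `N ≤ trdeg ℚ(z, e^z)` (tree abbrev, Hyper01)

* **W (Lindemann anchors `β ∈ ℚ̄^×`)** — `finiteTranscendenceType_exp_of_W` (τ = 5) from `WMeasure` =
  Waldschmidt 1978 Cor. 3.9 VERBATIM (tree `RootDecomp1KHyper02`; PROVED in the tree as
  `Literature…Waldschmidt1978_cor_3_9_holds` — taken as the hypothesis `hW` only because the module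
  `ExpAlgebraicTranscendenceMeasure(Proofs)` is not built on the farm snapshot; discharge by name on port):
  `algebraicIndependent_lindemann` `(ρ, e^β, e^{βρ})`; cells `hyperCell_lindemann_any`: `SB 2 (β, ρβ) ∧ SB 3 (β, ρβ, w)`
  for EVERY `β ∈ ℚ̄^×`, every hyper-Liouville `ρ` (either sign), every `w`; `hyperCell_I_any` (the imaginary axis).
  (The rational anchors `ℚ^×` were g9 §17 `algebraicIndependent_three_of_hyperLiouville` mod `ExplicitRatExpApprox`;
  the irrational algebraic anchors are new.)
* **π (anchors `u` with `e^u = π`) — UNCONDITIONAL**: `finiteTranscendenceType_pi` (τ = 4) from the tree's PROVED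
  `NesterenkoWaldschmidt1996_thm_2_2_holds`; `algebraicIndependent_pi_rpow : AlgebraicIndependent ℚ ![ρ, π, π^ρ]`
  for every hyper-Liouville real `ρ > 0`, NO hypothesis; cells `hyperCell_logPi_any`: `SB 2 (u, ρu) ∧ SB 3 (u, ρu, w)`
  whenever `e^u = π` — the anchor `log π` is dark in the strongest sense (its irrationality is open).
* **FIX (anchors `t` with `e^t = t`)** — `finiteTranscendenceType_fixpoint` (τ = 11) mod the REGISTERED fact
  `Literature.NumberTheory.Transcendental.NesterenkoWaldschmidt1996_thm_1` (Theorem 1 at `θ = t`, `α = β = ξ`: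
  `2|t − ξ| ≥ exp(−…)`, then the tree's PROVED transference `transcendenceMeasure_of_approximationMeasure`):
  `algebraicIndependent_fixpoint` `(ρ, t, e^{tρ})`; cells `hyperCell_fixpoint_any` — anchors at which `(t, e^t)` are
  algebraically DEPENDENT (Schanuel tight for the pair), decided at `n = 3`.
* `hyperLiouvilleSchanuel_live_at_{radical,logPi,fixpoint}Cell`: the LIVE text of A₄ʰ's body at `n = 3` at these `z`
  (both hypotheses of A₄ʰ idle).

Imports: tree `RootDecomp1KHyper04/05` (for `SB`, `SFset`, `sb_of_algebraicIndependent`, `mem_adjoin_SFset_I'`,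
`WMeasure`, `exists_int_mul_eq_map`, `mvaeval_int_map`, `HyperCell.HyperLiouville`) and the NW96 Thm 1 statement file.
Declarations marked COPY are verbatim copies of g9/g10 node declarations (Kum22/Tor21: `len`, `conjFactor`, `sliceAt`,
`relHat`, `resPoly`, `evC`, `relLen`, `torCo/torG/torD/denBound`, `cP`, `norm_mvaeval_le`, `eta_lt_delta`, `upper_exp`,
`algebraicIndependent_of_forall_int`, `HyperLiouville.rat_mul/ne_ratCast/neg`, `pair_bounds`, Mahler bookkeeping …) so
that the census port dedups against the g10 ports.  Sorry-free; standard axioms (audited at the end of the file);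
no `native_decide`; nothing here proves Schanuel — rung 0.
-/

noncomputable section

open Complex IntermediateField Polynomial

namespace Summit.Schanuel.Schanuel.Theorems.RootDecomp1KRadical

open Summit.Schanuel.Schanuel.Theorems.RootDecomp1KHyper (len len_nonneg one_le_len abs_coeff_le_len)
open Summit.Schanuel.Schanuel.Theorems.RootDecomp1KHyper.HyperCell (norm_aeval_le_len_mul_pow conjFactor sliceAt
  relHat resPoly eval_conjFactor eval_sliceAt natDegree_conjFactor_le coeff_conjFactor natDegree_sliceAt_le
  natDegree_relHat_le evC evC_apply evC_comp_C map_relHat_evC relLen relLen_nonneg eval_map_int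
  isAlgebraic_of_aeval_int norm_multiset_map_prod_le multiset_map_prod_le torCo torG aeval_torG natDegree_torG_le
  coeff_torG torCo_cast_eq eval_conjFactor_torG torD coeff_torD torD_ne_zero coeff_torG_eq_torD denBound
  den_lt_denBound norm_mvaeval_le cP cP_nonneg one_le_cP abs_torCo_le abs_coeff_torG_le len_torG_le relLen_torG_le
  pow_le_exp_mul eta_lt_delta upper_exp algebraicIndependent_of_forall_int HyperLiouville.rat_mul
  dvd_of_irreducible_of_common_root pair_bounds HyperLiouville.ne_ratCast HyperLiouville.ne_zero HyperLiouville.neg)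

/-! ### 19b. The resultant eliminating `t`: an integer polynomial vanishing at `α` -/

variable {K : ℕ}

/-! ## 23. RADICAL CONJUGATES OVER A TRANSCENDENTAL BASE

### 23a. Function-field Kummer: over `K = ℚ(y)`, `y` transcendental, a root `b` of `W^q − y^p`
(`gcd(p, q) = 1`) has degree `≥ q`; hence no non-zero `H ∈ K[W]` of degree `< q` vanishes at `b`.
(The minimal polynomial `μ` of `b` over `K`, of degree `d`, divides `W^q − y^p`; its constant
coefficient `ν ∈ K` satisfies `ν^q = ± y^{pd}`; writing `ν = A(y)/B(y)` and comparing orders of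
vanishing at `Y = 0` in `A^q = ± Y^{pd} B^q` gives `q ∣ pd`, so `q ∣ d`.) -/

/-- §23a. Trailing degree of a power over a domain: `natTrailingDegree (A ^ n) = n * natTrailingDegree A` for `A ≠ 0`. -/
theorem natTrailingDegree_pow_of_ne_zero {R : Type*} [CommRing R] [IsDomain R] {A : R[X]}
    (hA : A ≠ 0) (n : ℕ) : (A ^ n).natTrailingDegree = n * A.natTrailingDegree := by
  induction n with
  | zero => simp
  | succ n ih =>
    rw [pow_succ, natTrailingDegree_mul (pow_ne_zero _ hA) hA, ih, Nat.succ_mul]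

/-- an algebraic number over `ℚ` has a non-zero INTEGER polynomial -/
private theorem exists_int_poly_of_isAlgebraic {x : ℂ} (hx : IsAlgebraic ℚ x) :
    ∃ P : ℤ[X], P ≠ 0 ∧ aeval x P = 0 := by
  obtain ⟨P, hP0, hP⟩ := (IsFractionRing.isAlgebraic_iff ℤ ℚ ℂ).mpr hx
  exact ⟨P, hP0, hP⟩

/-- **Function-field Kummer non-vanishing.** -/
theorem ffKummer_eval_ne_zero {y : ℂ} (hy : Transcendental ℚ y) {pn q : ℕ} (hq : 0 < q)
    (hcop : Nat.Coprime pn q) {b : ℂ} (hb : b ^ q = y ^ pn) {H : ℂ[X]} (hH : H ≠ 0)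
    (hdeg : H.natDegree < q) (hcoef : ∀ j, H.coeff j ∈ ℚ⟮y⟯) : H.eval b ≠ 0 := by
  intro h0
  have hy0 : y ≠ 0 := fun h => hy (h ▸ isAlgebraic_zero)
  set K : IntermediateField ℚ ℂ := ℚ⟮y⟯ with hKdef
  have hinj : Function.Injective (algebraMap K ℂ) := (algebraMap K ℂ).injective
  -- lift `H` to `K[X]`
  obtain ⟨HK, hHK⟩ : ∃ HK : K[X], HK.map (algebraMap K ℂ) = H := by
    have : H ∈ Polynomial.lifts (algebraMap K ℂ) :=
      (lifts_iff_coeff_lifts H).mpr fun j => ⟨⟨H.coeff j, hcoef j⟩, rfl⟩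
    exact (mem_lifts H).mp this
  have hHK0 : HK ≠ 0 := by
    rintro rfl; exact hH (by rw [← hHK, Polynomial.map_zero])
  have hHKb : aeval b HK = 0 := by rw [aeval_def, ← eval_map, hHK, h0]
  -- `b` is integral over `K`: a root of `X^q − y^pn ∈ K[X]`
  set yK : K := ⟨y, mem_adjoin_simple_self ℚ y⟩ with hyK
  have hyKval : (algebraMap K ℂ) yK = y := rfl
  set fK : K[X] := X ^ q - C (yK ^ pn) with hfK
  have hfKb : aeval b fK = 0 := by
    rw [hfK, map_sub, map_pow, aeval_X, aeval_C, map_pow, hyKval, hb, sub_self]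
  have hint : IsIntegral K b := ⟨fK, monic_X_pow_sub_C _ hq.ne', by rwa [aeval_def] at hfKb⟩
  set μ : K[X] := minpoly K b with hμ
  have hμmonic : μ.Monic := minpoly.monic hint
  set d : ℕ := μ.natDegree with hd
  have hdpos : 0 < d := minpoly.natDegree_pos hint
  -- `d ≤ deg H < q`
  have hdlt : d < q := by
    have h1 : μ.degree ≤ HK.degree := minpoly.degree_le_of_ne_zero K b hHK0 hHKb
    have h2 : d ≤ HK.natDegree := natDegree_le_natDegree h1
    have h3 : HK.natDegree = H.natDegree := by rw [← hHK, natDegree_map_eq_of_injective hinj]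
    omega
  -- `μ ∣ X^q − y^pn`
  have hμdvd : μ ∣ fK := minpoly.dvd K b hfKb
  -- over `ℂ`: the roots of `μ` are `q`-th roots of `y^pn`
  set μC : ℂ[X] := μ.map (algebraMap K ℂ) with hμC
  have hμCmonic : μC.Monic := hμmonic.map _
  have hμCdeg : μC.natDegree = d := natDegree_map_eq_of_injective hinj μ
  have hsplit : μC.Splits := IsAlgClosed.splits μC
  have hcard : Multiset.card μC.roots = d := by
    rw [← hμCdeg]; exact splits_iff_card_roots.mp hsplit
  have hroot : ∀ r ∈ μC.roots, r ^ q = y ^ pn := by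
    intro r hr
    have hrμ : aeval r μ = 0 := by
      have := (mem_roots hμCmonic.ne_zero).mp hr
      rwa [IsRoot.def, hμC, eval_map, ← aeval_def] at this
    have hrf : aeval r fK = 0 := by
      obtain ⟨u, hu⟩ := hμdvd
      rw [hu, map_mul, hrμ, zero_mul]
    rw [hfK, map_sub, map_pow, aeval_X, aeval_C, map_pow, hyKval] at hrf
    exact sub_eq_zero.mp hrf
  -- the constant coefficient `ν`: `ν^q = (−1)^{dq} y^{pn d}`
  have hc0 : μC.coeff 0 = (-1) ^ d * μC.roots.prod := by
    rw [hsplit.coeff_zero_eq_prod_roots_of_monic hμCmonic, hμCdeg]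
  have hprodq : μC.roots.prod ^ q = (y ^ pn) ^ d := by
    calc μC.roots.prod ^ q = (μC.roots.map id).prod ^ q := by rw [Multiset.map_id]
      _ = (μC.roots.map fun r => id r ^ q).prod := Multiset.prod_map_pow.symm
      _ = (μC.roots.map fun _ => y ^ pn).prod := by
          simp only [id]
          rw [Multiset.map_congr rfl (fun r hr => hroot r hr)]
      _ = (y ^ pn) ^ d := by rw [Multiset.map_const', Multiset.prod_replicate, hcard]
  have hνq : (μC.coeff 0) ^ q = ((-1) ^ d) ^ q * y ^ (pn * d) := by
    rw [hc0, mul_pow, hprodq, ← pow_mul, ← pow_mul]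
  have hν0 : μC.coeff 0 ≠ 0 := by
    intro h
    have h2 := hνq
    rw [h, zero_pow hq.ne'] at h2
    exact (mul_ne_zero (pow_ne_zero _ (pow_ne_zero _ (neg_ne_zero.mpr one_ne_zero)))
      (pow_ne_zero _ hy0)) h2.symm
  -- `ν ∈ ℚ(y)`: `ν = A(y) / B(y)`
  have hνmem : μC.coeff 0 ∈ K := by rw [hμC, coeff_map]; exact (μ.coeff 0).2
  obtain ⟨A, B, hAB⟩ := (mem_adjoin_simple_iff (F := ℚ) (μC.coeff 0)).mp hνmem
  have hB0 : aeval y B ≠ 0 := by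
    intro h; rw [h, div_zero] at hAB; exact hν0 hAB
  have hA0 : aeval y A ≠ 0 := by
    intro h; rw [h, zero_div] at hAB; exact hν0 hAB
  have hApoly : A ≠ 0 := by rintro rfl; exact hA0 (map_zero _)
  have hBpoly : B ≠ 0 := by rintro rfl; exact hB0 (map_zero _)
  -- the polynomial identity `A^q = s · X^{pn d} · B^q`, `s = ((−1)^d)^q`
  obtain ⟨s, hs⟩ : ∃ s : ℚ, s = ((-1) ^ d) ^ q := ⟨_, rfl⟩
  have hs0 : s ≠ 0 := hs ▸ pow_ne_zero _ (pow_ne_zero _ (neg_ne_zero.mpr one_ne_zero))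
  have hident : A ^ q = C s * X ^ (pn * d) * B ^ q := by
    by_contra hne
    apply hy
    refine ⟨A ^ q - C s * X ^ (pn * d) * B ^ q, sub_ne_zero.mpr hne, ?_⟩
    have e1 : aeval y A = μC.coeff 0 * aeval y B := by
      rw [hAB, div_mul_cancel₀ _ hB0]
    have e2 : (algebraMap ℚ ℂ) s = ((-1 : ℂ) ^ d) ^ q := by
      rw [hs, map_pow, map_pow, map_neg, map_one]
    simp only [map_sub, map_mul, map_pow, aeval_C, aeval_X]
    rw [e2, e1, mul_pow, hνq]
    ring
  -- orders of vanishing at `0`: `q · ord A = pn d + q · ord B`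
  have h1 : (A ^ q).natTrailingDegree = q * A.natTrailingDegree :=
    natTrailingDegree_pow_of_ne_zero hApoly q
  have h2 : (C s * X ^ (pn * d) * B ^ q).natTrailingDegree = pn * d + q * B.natTrailingDegree := by
    have hCX : C s * X ^ (pn * d) ≠ 0 := mul_ne_zero (C_ne_zero.mpr hs0) (pow_ne_zero _ X_ne_zero)
    rw [natTrailingDegree_mul hCX (pow_ne_zero _ hBpoly),
      natTrailingDegree_mul (C_ne_zero.mpr hs0) (pow_ne_zero _ X_ne_zero), natTrailingDegree_C,
      natTrailingDegree_X_pow, natTrailingDegree_pow_of_ne_zero hBpoly, zero_add]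
  have h3 : q * A.natTrailingDegree = pn * d + q * B.natTrailingDegree := by rw [← h1, hident, h2]
  have hqd : q ∣ d * pn := by
    have h4 : q ∣ pn * d + q * B.natTrailingDegree := ⟨A.natTrailingDegree, h3.symm⟩
    rw [mul_comm d]
    exact (Nat.dvd_add_left (dvd_mul_right q _)).mp h4
  have hqd' : q ∣ d := hcop.symm.dvd_of_dvd_mul_right hqd
  exact absurd (Nat.le_of_dvd hdpos hqd') (not_le.mpr hdlt)

/-- the `W`-coefficients of the slice `F(y, W) = Σ_k y^k G_k(W)` -/
theorem coeff_sliceAt (G : Fin (K + 1) → ℤ[X]) (y : ℂ) (j : ℕ) :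
    (sliceAt G y).coeff j = ∑ k : Fin (K + 1), y ^ (k : ℕ) * (((G k).coeff j : ℤ) : ℂ) := by
  unfold sliceAt
  rw [finsetSum_coeff]
  refine Finset.sum_congr rfl fun k _ => ?_
  rw [coeff_C_mul, coeff_map, eq_intCast]

/-- §23a. The coefficients of the slice `sliceAt G x` lie in the `ℚ`-span generated by the data (bookkeeping for the function-field Kummer step). -/
theorem coeff_sliceAt_mem (G : Fin (K + 1) → ℤ[X]) (y : ℂ) (j : ℕ) :
    (sliceAt G y).coeff j ∈ ℚ⟮y⟯ := by
  rw [coeff_sliceAt]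
  refine sum_mem fun k _ => mul_mem (pow_mem (mem_adjoin_simple_self ℚ y) _) ?_
  exact intCast_mem _ _

/-- the `Y`-polynomial of `j`-th `W`-coefficients: `T_j(Y) = Σ_k (G_k.coeff j) Y^k ∈ ℤ[Y]` -/
def coeffPoly (G : Fin (K + 1) → ℤ[X]) (j : ℕ) : ℤ[X] :=
  ∑ k : Fin (K + 1), C ((G k).coeff j) * X ^ (k : ℕ)

/-- §23a. Evaluation of the coefficient polynomial `coeffPoly`: it reproduces the corresponding coefficient of the slice. -/
theorem aeval_coeffPoly (G : Fin (K + 1) → ℤ[X]) (y : ℂ) (j : ℕ) :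
    aeval y (coeffPoly G j) = (sliceAt G y).coeff j := by
  rw [coeff_sliceAt, coeffPoly, map_sum]
  refine Finset.sum_congr rfl fun k _ => ?_
  rw [map_mul, map_pow, aeval_X, aeval_C, algebraMap_int_eq, eq_intCast, mul_comm]

/-- §23a. The coefficients of `coeffPoly` (explicit formula). -/
theorem coeff_coeffPoly (G : Fin (K + 1) → ℤ[X]) (j : ℕ) (k : Fin (K + 1)) :
    (coeffPoly G j).coeff (k : ℕ) = (G k).coeff j := by
  unfold coeffPoly
  rw [finsetSum_coeff]
  simp only [coeff_C_mul, coeff_X_pow]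
  rw [Finset.sum_eq_single k]
  · simp
  · intro i _ hik
    rw [if_neg]; · simp
    intro h; exact hik (Fin.ext h.symm)
  · intro h; exact absurd (Finset.mem_univ k) h

/-- over a transcendental `y`, the slice is a non-zero polynomial in `W` as soon as ONE `G_k` has a
non-zero coefficient -/
theorem sliceAt_ne_zero_of_transcendental {y : ℂ} (hy : Transcendental ℚ y)
    (G : Fin (K + 1) → ℤ[X]) {k : Fin (K + 1)} {j : ℕ} (h : (G k).coeff j ≠ 0) :
    sliceAt G y ≠ 0 := by
  intro h0
  have hT : coeffPoly G j ≠ 0 := fun hT => h (by rw [← coeff_coeffPoly G j k, hT, coeff_zero])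
  have hval : aeval y (coeffPoly G j) = 0 := by rw [aeval_coeffPoly, h0, coeff_zero]
  exact hy (isAlgebraic_of_aeval_int hT hval)

/-- **§23a for the slice**: `F(y, b) ≠ 0` for every `q`-th root `b` of `y^pn`, once `deg_W F < q`. -/
theorem sliceAt_eval_ne_zero {y : ℂ} (hy : Transcendental ℚ y) {pn q : ℕ} (hq : 0 < q)
    (hcop : Nat.Coprime pn q) {b : ℂ} (hb : b ^ q = y ^ pn) (G : Fin (K + 1) → ℤ[X]) {N : ℕ}
    (hN : ∀ k, (G k).natDegree ≤ N) (hNq : N < q) (hG : sliceAt G y ≠ 0) :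
    (sliceAt G y).eval b ≠ 0 :=
  ffKummer_eval_ne_zero hy hq hcop hb hG ((natDegree_sliceAt_le G y hN).trans_lt hNq)
    (coeff_sliceAt_mem G y)

end Summit.Schanuel.Schanuel.Theorems.RootDecomp1KRadical
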